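import Mathlib
import HarnessLib
import Literature.Probability.MarkovChains.Cutoff
import Literature.Probability.MarkovChains.RelaxationTime

/-!
# Pre-cutoff (Levin–Peres–Wilmer (18.5)) and the necessary condition `t_mix/(t_rel − 1) → ∞` (Proposition 18.4)

HONEST FRAMING: exact (Metropolis-corrected) sampling algorithms for lattice gauge theory; figures
of merit are autocorrelation/cost numbers at stated couplings and volumes; no continuum-physics claim.

Topic `Probability/MarkovChains`; namespace `Literature.Probability.MarkovChains`.  Vocabulary of
`Cutoff.lean` (a sequence of chains given through its mixing-time profile `tmix n ε = t_mix^{(n)}(ε)`,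
`HasCutoff`, (18.3)) and `RelaxationTime.lean` (`relaxationTime P = t_rel`, `lambdaStar`, and
THEOREM 12.5 / eq. (12.14) `LevinPeres2017_eq_12_14_tmix`: `t_mix(ε) ≥ (t_rel − 1) log(1/(2ε))`),
`BottleneckRatio.lean` (`mixingTime P π ε`, `worstTvDist`).  Source: D. A. Levin, Y. Peres (with
E. L. Wilmer), *Markov Chains and Mixing Times*, 2nd ed., AMS 2017 [LevinPeres2017], §18.1 eq. (18.5)
and §18.3 Proposition 18.4 with its proof (p. 267).  EVERYTHING IS PROVED (0 named facts).

* **(18.5)** `HasPreCutoff tmix` — the sequence has a PRE-CUTOFF: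
  `sup_{0<ε<1/2} limsup_{n→∞} t_mix^{(n)}(ε)/t_mix^{(n)}(1 − ε) < ∞` [cite: LevinPeres2017, §18.1
  eq. (18.5)].  TYPED FORM (declared): "there is `C` such that for every `ε ∈ (0, ½)`, eventually
  `t_mix^{(n)}(ε) ≤ C · t_mix^{(n)}(1 − ε)`" — the product form of the printed bound on the ratios
  (equivalent to (18.5) whenever the `t_mix^{(n)}(1 − ε)` are positive, and free of `0/0` conventions);
  `HasCutoff.hasPreCutoff` — cutoff implies pre-cutoff (for profiles non-increasing in `ε`).
* **PROPOSITION 18.4** `LevinPeres2017_prop_18_4` — for a sequence of chains each satisfying (12.14)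
  (`t_mix^{(n)}(ε) ≥ (t_rel^{(n)} − 1) log(1/(2ε))` for `0 < ε < 1`: irreducible aperiodic reversible
  chains, Theorem 12.5) with `t_rel^{(n)} ≥ 1` and `ε ↦ t_mix^{(n)}(ε)` non-increasing, a pre-cutoff
  forces `t_mix^{(n)}/(t_rel^{(n)} − 1) → ∞`, typed as `(t_rel^{(n)} − 1)/t_mix^{(n)} → 0` with
  `t_mix^{(n)} = t_mix^{(n)}(1/4)` [cite: LevinPeres2017, §18.3 Prop. 18.4].  Proof as printed (divide
  (12.14) by `t_mix^{(n)}`, bound `t_mix^{(n)}(ε)/t_mix^{(n)} ≤ C` through the pre-cutoff and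
  `t_mix(1 − ε) ≤ t_mix(1/4)`, and let `ε → 0`), run directly rather than by contradiction.
* `LevinPeres2017_prop_18_4_chain` — the same for an explicit sequence of finite chains
  `(P n, π n)` on state spaces `X n` (stationary `π n`, `λ⋆ < 1`, `d^{(n)}(t) → 0`), with (12.14)
  supplied by `LevinPeres2017_eq_12_14_tmix` and the monotonicity of `ε ↦ t_mix(ε)` proved here
  (`mixingTime_anti`) [cite: LevinPeres2017, §18.3 Prop. 18.4 with §12.2 Thm 12.5 eq. (12.14)].

Context (cell pub-lqcd, venture LatticeQCDFlow): when a sampler family is reported with "a" mixing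
time, pre-cutoff/cutoff is the regime where that number is meaningful to leading order; Proposition
18.4 is the cheap falsifier — if `t_mix` and `t_rel` are of the same order there is no pre-cutoff.
-/

namespace Literature.Probability.MarkovChains

open Set Filter Topology

/-! ## (18.5) Pre-cutoff -/

/-- **(18.5): PRE-CUTOFF.**  `sup_{0<ε<1/2} limsup_n t_mix^{(n)}(ε)/t_mix^{(n)}(1−ε) < ∞`, in product
form: some `C` bounds `t_mix^{(n)}(ε) ≤ C·t_mix^{(n)}(1 − ε)` eventually in `n`, for every
`ε ∈ (0, ½)`. [cite: LevinPeres2017, §18.1 eq. (18.5)] -/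
def HasPreCutoff (tmix : ℕ → ℝ → ℝ) : Prop :=
  ∃ C : ℝ, ∀ ε : ℝ, 0 < ε → ε < 1 / 2 → ∀ᶠ n in atTop, tmix n ε ≤ C * tmix n (1 - ε)

/-- Unfolding lemma. [cite: LevinPeres2017, §18.1 eq. (18.5)] -/
theorem hasPreCutoff_iff (tmix : ℕ → ℝ → ℝ) :
    HasPreCutoff tmix ↔
      ∃ C : ℝ, ∀ ε : ℝ, 0 < ε → ε < 1 / 2 → ∀ᶠ n in atTop, tmix n ε ≤ C * tmix n (1 - ε) :=
  Iff.rfl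

/-- Cutoff implies pre-cutoff ("t_mix(ε)/t_mix(1−ε) → 1", so the ratios are eventually `≤ 2`), for
profiles with `t_mix^{(n)}(1 − ε) ≥ 0`. [cite: LevinPeres2017, §18.1 eqs. (18.3), (18.5) ("a pre-cutoff
is a weaker property")] -/
theorem HasCutoff.hasPreCutoff {tmix : ℕ → ℝ → ℝ} (h : HasCutoff tmix)
    (hpos : ∀ ε : ℝ, 0 < ε → ε < 1 / 2 → ∀ᶠ n in atTop, 0 < tmix n (1 - ε)) :
    HasPreCutoff tmix := by
  refine ⟨2, fun ε hε hε2 => ?_⟩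
  have hlt1 : ε < 1 := by linarith
  have ht := h ε hε hlt1
  -- eventually the ratio is `< 2`
  have hev : ∀ᶠ n in atTop, tmix n ε / tmix n (1 - ε) < 2 :=
    (tendsto_order.1 ht).2 2 (by norm_num)
  filter_upwards [hev, hpos ε hε hε2] with n hn hp
  rw [div_lt_iff₀ hp] at hn
  exact hn.le

/-! ## Proposition 18.4 -/

/-- **Proposition 18.4.**  For a sequence of chains with relaxation times `trel n` and mixing-time
profiles `tmix n ε ≥ 0` such that each chain satisfies (12.14),
`t_mix^{(n)}(ε) ≥ (t_rel^{(n)} − 1)·log(1/(2ε))` for `0 < ε < 1` (Theorem 12.5: irreducible aperiodic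
reversible chains), `t_rel^{(n)} ≥ 1`, and `ε ↦ t_mix^{(n)}(ε)` non-increasing on `(0,1)`: if there is
a pre-cutoff, then `t_mix^{(n)}/(t_rel^{(n)} − 1) → ∞`, i.e. `(t_rel^{(n)} − 1)/t_mix^{(n)} → 0`
(`t_mix = t_mix(1/4)`). [cite: LevinPeres2017, §18.3 Prop. 18.4] -/
theorem LevinPeres2017_prop_18_4 {tmix : ℕ → ℝ → ℝ} {trel : ℕ → ℝ}
    (h1214 : ∀ n (ε : ℝ), 0 < ε → ε < 1 → (trel n - 1) * Real.log (1 / (2 * ε)) ≤ tmix n ε)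
    (htrel : ∀ n, 1 ≤ trel n) (hnn : ∀ n (ε : ℝ), 0 < ε → ε < 1 → 0 ≤ tmix n ε)
    (hanti : ∀ n (ε ε' : ℝ), 0 < ε → ε ≤ ε' → ε' < 1 → tmix n ε' ≤ tmix n ε)
    (hpre : HasPreCutoff tmix) :
    Tendsto (fun n => (trel n - 1) / tmix n (1 / 4)) atTop (𝓝 0) := by
  obtain ⟨C, hC⟩ := hpre
  set C' : ℝ := max C 1 with hC'
  have hC'pos : 0 < C' := lt_of_lt_of_le one_pos (le_max_right _ _)
  have hnonneg : ∀ n, 0 ≤ (trel n - 1) / tmix n (1 / 4) := fun n =>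
    div_nonneg (by linarith [htrel n]) (hnn n (1 / 4) (by norm_num) (by norm_num))
  rw [Metric.tendsto_atTop]
  intro δ hδ
  -- choose `ε ∈ (0, ½)` with `log(1/(2ε)) ≥ 2C'/δ`
  set ε : ℝ := min (1 / 4) (Real.exp (-(2 * C' / δ)) / 2) with hεdef
  have hεpos : 0 < ε := lt_min (by norm_num) (by positivity)
  have hε4 : ε ≤ 1 / 4 := min_le_left _ _
  have hε2 : ε < 1 / 2 := by linarith
  have hlogε : 2 * C' / δ ≤ Real.log (1 / (2 * ε)) := by
    have h2ε : 2 * ε ≤ Real.exp (-(2 * C' / δ)) := by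
      have := min_le_right (1 / 4 : ℝ) (Real.exp (-(2 * C' / δ)) / 2)
      rw [← hεdef] at this
      linarith
    have h2εpos : 0 < 2 * ε := by linarith
    calc 2 * C' / δ = Real.log (1 / Real.exp (-(2 * C' / δ))) := by
          rw [one_div, Real.log_inv, Real.log_exp]; ring
      _ ≤ Real.log (1 / (2 * ε)) := by
          apply Real.log_le_log (by positivity)
          exact one_div_le_one_div_of_le h2εpos h2ε
  have hlogpos : 0 < Real.log (1 / (2 * ε)) := lt_of_lt_of_le (by positivity) hlogε
  obtain ⟨N, hN⟩ := eventually_atTop.1 (hC ε hεpos hε2)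
  refine ⟨N, fun n hn => ?_⟩
  rw [Real.dist_eq, sub_zero, abs_of_nonneg (hnonneg n)]
  -- `(trel − 1) log(1/2ε) ≤ tmix ε ≤ C tmix(1−ε) ≤ C' tmix(1−ε) ≤ C' tmix(1/4)`
  have ht1ε : 0 ≤ tmix n (1 - ε) := hnn n (1 - ε) (by linarith) (by linarith)
  have hchain : (trel n - 1) * Real.log (1 / (2 * ε)) ≤ C' * tmix n (1 / 4) := by
    have h1 := h1214 n ε hεpos (by linarith)
    have h2 := hN n hn
    have h3 : C * tmix n (1 - ε) ≤ C' * tmix n (1 - ε) :=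
      mul_le_mul_of_nonneg_right (le_max_left _ _) ht1ε
    have h4 : C' * tmix n (1 - ε) ≤ C' * tmix n (1 / 4) :=
      mul_le_mul_of_nonneg_left (hanti n (1 / 4) (1 - ε) (by norm_num) (by linarith) (by linarith))
        hC'pos.le
    linarith
  by_cases ht0 : tmix n (1 / 4) = 0
  · rw [ht0, div_zero]; exact hδ
  · have htpos : 0 < tmix n (1 / 4) :=
      lt_of_le_of_ne (hnn n (1 / 4) (by norm_num) (by norm_num)) (Ne.symm ht0)
    rw [div_lt_iff₀ htpos]
    have h5 : (trel n - 1) * Real.log (1 / (2 * ε)) * δ ≤ C' * tmix n (1 / 4) * δ :=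
      mul_le_mul_of_nonneg_right hchain hδ.le
    have h6 : C' * δ ≤ (δ / 2) * Real.log (1 / (2 * ε)) * δ := by
      have := mul_le_mul_of_nonneg_left hlogε (show (0 : ℝ) ≤ δ / 2 by linarith)
      have e : δ / 2 * (2 * C' / δ) = C' := by field_simp
      nlinarith
    -- from h5, h6: (trel-1)·L·δ ≤ C'·t·δ ≤ (δ/2)·L·δ·t, divide by L·δ > 0
    have hLδ : 0 < Real.log (1 / (2 * ε)) * δ := mul_pos hlogpos hδ
    have h7 : (trel n - 1) * (Real.log (1 / (2 * ε)) * δ) ≤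
        (δ / 2 * tmix n (1 / 4)) * (Real.log (1 / (2 * ε)) * δ) := by
      have h6' := mul_le_mul_of_nonneg_right h6 htpos.le
      nlinarith
    have h8 := le_of_mul_le_mul_right h7 hLδ
    nlinarith

/-! ## The statement for an explicit sequence of finite chains -/

section Chains

variable {X : ℕ → Type*} [∀ n, Fintype (X n)] [∀ n, DecidableEq (X n)]

/-- `ε ↦ t_mix(ε)` is non-increasing: `ε ≤ ε'` and `d(t) ≤ ε` for some `t` give
`t_mix(ε') ≤ t_mix(ε)`. [cite: LevinPeres2017, §4.5 eq. (4.32)] -/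
theorem mixingTime_anti {Y : Type*} [Fintype Y] [DecidableEq Y] (P : Y → Y → ℝ) (π : Y → ℝ) {ε ε' : ℝ}
    (h : ε ≤ ε') (hmix : ∃ t, worstTvDist P π t ≤ ε) :
    mixingTime P π ε' ≤ mixingTime P π ε := by
  obtain ⟨t₀, ht₀⟩ := hmix
  have hat : worstTvDist P π (mixingTime P π ε) ≤ ε := worstTvDist_mixingTime_le P π ht₀
  exact Nat.sInf_le (hat.trans h)

/-- **Proposition 18.4 for a sequence of finite chains** `(P n, π n)`: stationary `π n`, `λ⋆(P n) < 1`
and `d^{(n)}(t) → 0` (so that every `t_mix^{(n)}(ε)` is attained; e.g. irreducible aperiodic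
reversible chains), then a pre-cutoff of `(n, ε) ↦ t_mix^{(n)}(ε)` forces
`(t_rel^{(n)} − 1)/t_mix^{(n)} → 0`. [cite: LevinPeres2017, §18.3 Prop. 18.4 with §12.2 Thm 12.5
eq. (12.14)] -/
theorem LevinPeres2017_prop_18_4_chain (P : ∀ n, X n → X n → ℝ) (π : ∀ n, X n → ℝ)
    (hst : ∀ n, IsStationary (π n) (P n)) (hgap : ∀ n, lambdaStar (P n) < 1)
    (hconv : ∀ n (ε : ℝ), 0 < ε → ∃ t, worstTvDist (P n) (π n) t ≤ ε)
    (hpre : HasPreCutoff fun n ε => (mixingTime (P n) (π n) ε : ℝ)) :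
    Tendsto (fun n => (relaxationTime (P n) - 1) / (mixingTime (P n) (π n) (1 / 4) : ℝ))
      atTop (𝓝 0) := by
  refine LevinPeres2017_prop_18_4 (tmix := fun n ε => (mixingTime (P n) (π n) ε : ℝ))
    (fun n ε hε _ => LevinPeres2017_eq_12_14_tmix (hst n) (hgap n) hε (hconv n ε hε))
    (fun n => ?_) (fun n ε _ _ => Nat.cast_nonneg _)
    (fun n ε ε' hε hle _ => by exact_mod_cast mixingTime_anti (P n) (π n) hle (hconv n ε hε)) hpre
  -- `t_rel = 1/γ⋆ ≥ 1` since `0 < γ⋆ ≤ 1`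
  have h1 : 0 < absSpectralGap (P n) := by unfold absSpectralGap; linarith [hgap n]
  have h2 : absSpectralGap (P n) ≤ 1 := by
    unfold absSpectralGap; linarith [lambdaStar_nonneg (P n)]
  unfold relaxationTime
  rw [le_div_iff₀ h1, one_mul]
  exact h2

end Chains

end Literature.Probability.MarkovChains
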